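import Summits.BirchSwinnertonDyer.Statement
import Literature.StrongHypotheses.BirchSwinnertonDyer
import Literature.NumberTheory.EllipticCurves.GlobalMinimalModelProofs
import Literature.NumberTheory.EllipticCurves.BSDInvariantsProofs
import HarnessLib
import HarnessLib.Audit.TribunalTags

/-!
# Summit `BirchSwinnertonDyer` — bridges of the Strong-Hypothesis Library (D-0034, skeleton)

Summit-side BRIDGE file for the registry `Literature/StrongHypotheses/BirchSwinnertonDyer.lean`: for every `H`
tagged there with `@[strong_hypothesis "BirchSwinnertonDyer.BirchSwinnertonDyer"]`, exactly ONE bridge tagged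
`@[summit_bridge "BirchSwinnertonDyer.BirchSwinnertonDyer"]`, concluding the ROOT problem decl
`_root_.BirchSwinnertonDyer` (`Summits/BirchSwinnertonDyer/BirchSwinnertonDyer/Statement.lean`;
`:= Literature.BSDRankConjecture := ∀ W : WeierstrassCurve ℚ, W.IsElliptic → W.analyticRank = W.mordellWeilRank`).

* LANDED bridge (1): `bsdConjecture_implies_birchSwinnertonDyer` — full refined BSD over `ℚ`
  (`Literature.NumberTheory.EllipticCurves.BSDConjecture`, RANK ∧ SHAFIN ∧ LEAD over globally minimal models)
  implies the summit: a five-line composition of theorems already proved in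
  `Literature/NumberTheory/EllipticCurves/GlobalMinimalModelProofs.lean` (`hasGlobalMinimalModel_rat_holds`,
  Néron 1964 / Silverman VIII.8.3) and `BSDInvariantsProofs.lean` (`analyticRank_variableChange_holds`,
  `mordellWeilRank_variableChange_holds`, Silverman III.3.1(b), C.16 with VII.1.3(b)).
* PRINTED bridge (1): `BSDRankConjectureNFImpliesBirchSwinnertonDyer` — the rank conjecture over every number
  field (`Literature.StrongHypotheses.BirchSwinnertonDyer.BSDRankConjectureNF`, with its explicit continuation
  hypothesis) implies the summit: specialise `K = ℚ` and discharge the continuation hypothesis by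
  `WeierstrassCurve.hasEntireLFunction_rat` (BCDT 2001 Thm. A), a named fact NOT yet discharged in the tree —
  hence a NAMED FACT here (CONVENTIONS §4), to be landed as
  `theorem BSDRankConjectureNFImpliesBirchSwinnertonDyer_holds` in
  `Summits/BirchSwinnertonDyer/BirchSwinnertonDyer/Theorems/StrongHypothesesBSDRankConjectureNFBridge.lean`
  once `hasEntireLFunction_rat_holds` exists (proof plan in the docstring).

No summit-side conjecture `def` (closed `Prop` under `Summits/BirchSwinnertonDyer/**/Cruxes|Theorems`) exists to
tag in place. No new mathematics is proved here; no `sorry`, no axiom.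
-/

noncomputable section

namespace Summit.BirchSwinnertonDyer.StrongHypotheses

open WeierstrassCurve
open Literature.NumberTheory.EllipticCurves
open Literature.StrongHypotheses.BirchSwinnertonDyer

/-! ## Strictly stronger hypotheses -/

/-- **Full BSD ⟹ RANK** (landed): the refined Birch–Swinnerton-Dyer conjecture over `ℚ`
(`BSDConjecture`: RANK ∧ SHAFIN ∧ LEAD for every globally minimal elliptic `W/ℚ`) implies the summit. Given
an elliptic `W/ℚ`, take a global minimal model `C • W` (`hasGlobalMinimalModel_rat_holds`, Silverman *AEC*
VIII.8.3), read off its RANK clause, and transport it back along the isomorphism `W ≅ C • W`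
(`analyticRank_variableChange_holds`, `mordellWeilRank_variableChange_holds`). This is the "no loss of
generality" remark of `bsdConjecture_iff_forall_hasModel` restricted to the rank clause.
[cite: Wiles2006BSDClay, §1, Conjecture (Birch and Swinnerton-Dyer) and Remarks 1, CMI offprint p. 2] -/
@[summit_bridge "BirchSwinnertonDyer.BirchSwinnertonDyer"]
theorem bsdConjecture_implies_birchSwinnertonDyer : BSDConjecture → _root_.BirchSwinnertonDyer := by
  intro h W hE
  haveI := hE
  obtain ⟨C, hC⟩ := hasGlobalMinimalModel_rat_holds W
  have h1 := (h (C • W) inferInstance hC).1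
  have ha : (C • W).analyticRank = W.analyticRank := analyticRank_variableChange_holds W C
  have hm : (C • W).mordellWeilRank = W.mordellWeilRank := mordellWeilRank_variableChange_holds W C
  rwa [ha, hm] at h1

/-- **BSD-rank over every number field ⟹ RANK over `ℚ`** — named fact: `BSDRankConjectureNF` (Tate 1966
§1 Conj. (A) in dimension `1`; Gross 2011 Conj. 2.10 (1)) implies the summit. Printed content of the
implication: the case `K = ℚ` of the hypothesis is `∀ W/ℚ` elliptic, `W.HasEntireLFunction → r_an = rank`, and
`W.HasEntireLFunction` holds for every elliptic `W/ℚ` by the modularity theorem, Breuil–Conrad–Diamond–Taylor,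
JAMS 14 (2001), Thm. A with Hecke/Carayol (Silverman *AEC* Thm. C.16.3) — in tree the NAMED FACT
`WeierstrassCurve.hasEntireLFunction_rat` (`AnalyticRank.lean`), reduced to the BCDT/CDT leaves in
`AnalyticRankBCDTTheoremBProofs` but not discharged. PROOF PLAN for
`theorem BSDRankConjectureNFImpliesBirchSwinnertonDyer_holds`: `fun h W hE => h ℚ W hE (hasEntireLFunction_rat_holds
W)` — one line once `hasEntireLFunction_rat_holds : hasEntireLFunction_rat` is landed; today the conditional
form `BSDRankConjectureNF → hasEntireLFunction_rat → BirchSwinnertonDyer` is `fun h he W hE => h ℚ W hE (@he W hE)`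
(checked on the farm, not landed here to keep one bridge per `H`).
[cite: BCDTJAMS2001, Theorem A] -/
@[summit_bridge "BirchSwinnertonDyer.BirchSwinnertonDyer"]
def BSDRankConjectureNFImpliesBirchSwinnertonDyer : Prop :=
  BSDRankConjectureNF → _root_.BirchSwinnertonDyer

end Summit.BirchSwinnertonDyer.StrongHypotheses
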